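import Mathlib

/-!
# Coprime-order decomposition of a finite abelian group (kernel witness for the standard fact (A3)(c))

Blind cell `pub-hodge-repro2`, seat p4, Tier-5 support. README §8(d): this file uses an
L-value-free non-vanishing device: NO (it is a kernel check of a standard fact already on the
cell's record).

The standard fact (A3)(c) of `route/T5-route-2.md` §N5.11.7 (owner route-2, sub-step N5), used in
the global descent Theorem N5.T3, reads: «a finite abelian group of order `m·n` with
`gcd(m, n) = 1` is the direct product of its subgroups of orders `m` and `n`».

We prove it in the explicit form: for a finite commutative group `G` with `Nat.card G = m * n` and
`Nat.Coprime m n`, the subgroups `powKer m = {g | g ^ m = 1}` and `powKer n = {g | g ^ n = 1}`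
* intersect trivially (`powKer_disjoint`),
* generate `G` (`powKer_sup_eq_top`, Bézout),
* are complementary in Mathlib's sense (`isComplement'_powKer`),
* have orders exactly `m` and `n` (`card_powKer_left`, `card_powKer_right`; Cauchy + Lagrange),
* and multiplication `powKer m × powKer n → G` is a group isomorphism (`mulEquivProd`).

Mathlib only; no sorry; axioms ⊆ {propext, Classical.choice, Quot.sound}.
-/

namespace Summit.Ventures.HodgeRepro2.T5CoprimeDecomposition

open Subgroup

variable {G : Type*} [CommGroup G]

/-- The subgroup of a commutative group killed by the `m`-th power map: `{g | g ^ m = 1}`. -/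
def powKer (G : Type*) [CommGroup G] (m : ℕ) : Subgroup G where
  carrier := {g | g ^ m = 1}
  one_mem' := by simp
  mul_mem' := by
    intro a b ha hb
    simp only [Set.mem_setOf_eq] at ha hb ⊢
    rw [mul_pow, ha, hb, one_mul]
  inv_mem' := by
    intro a ha
    simp only [Set.mem_setOf_eq] at ha ⊢
    rw [inv_pow, ha, inv_one]

/-- Membership in `powKer G m`. -/
theorem mem_powKer {m : ℕ} {g : G} : g ∈ powKer G m ↔ g ^ m = 1 := Iff.rfl

/-- The `m`-kernel and the `n`-kernel meet trivially when `gcd(m, n) = 1`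
(the order of a common element divides `gcd(m, n) = 1`). -/
theorem powKer_disjoint {m n : ℕ} (h : Nat.Coprime m n) :
    Disjoint (powKer G m) (powKer G n) := by
  rw [Subgroup.disjoint_def]
  intro g hm hn
  have h1 : orderOf g ∣ m := orderOf_dvd_of_pow_eq_one hm
  have h2 : orderOf g ∣ n := orderOf_dvd_of_pow_eq_one hn
  have h3 : orderOf g ∣ Nat.gcd m n := Nat.dvd_gcd h1 h2
  rw [h.gcd_eq_one, Nat.dvd_one] at h3
  exact orderOf_eq_one_iff.mp h3

/-- Bézout: if every element is killed by `m * n` and `gcd(m, n) = 1`, then every element is a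
product of an element killed by `m` and an element killed by `n`:
`g = (g ^ n) ^ v * (g ^ m) ^ u` with `u * m + v * n = 1` in `ℤ`. -/
theorem exists_mul_eq_of_pow_mul_eq_one {m n : ℕ} (h : Nat.Coprime m n) (g : G)
    (hg : g ^ (m * n) = 1) :
    ∃ a ∈ powKer G m, ∃ b ∈ powKer G n, a * b = g := by
  obtain ⟨u, v, huv⟩ := Nat.isCoprime_iff_coprime.mpr h
  refine ⟨(g ^ n) ^ v, ?_, (g ^ m) ^ u, ?_, ?_⟩
  · rw [mem_powKer, ← zpow_natCast, ← zpow_mul, mul_comm, zpow_mul, zpow_natCast, ← pow_mul,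
      mul_comm, hg, one_zpow]
  · rw [mem_powKer, ← zpow_natCast, ← zpow_mul, mul_comm, zpow_mul, zpow_natCast, ← pow_mul, hg,
      one_zpow]
  · calc (g ^ n) ^ v * (g ^ m) ^ u = g ^ (v * (n : ℤ)) * g ^ (u * (m : ℤ)) := by
          rw [← zpow_natCast, ← zpow_mul, ← zpow_natCast, ← zpow_mul, mul_comm (n : ℤ),
            mul_comm (m : ℤ)]
      _ = g ^ (u * (m : ℤ) + v * (n : ℤ)) := by rw [zpow_add, mul_comm]
      _ = g := by rw [huv, zpow_one]

/-- If every element is killed by `m * n` and `gcd(m, n) = 1`, the two kernels generate `G`. -/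
theorem powKer_sup_eq_top {m n : ℕ} (h : Nat.Coprime m n) (hG : ∀ g : G, g ^ (m * n) = 1) :
    powKer G m ⊔ powKer G n = ⊤ := by
  rw [eq_top_iff]
  intro g _
  obtain ⟨a, ha, b, hb, rfl⟩ := exists_mul_eq_of_pow_mul_eq_one h g (hG g)
  exact Subgroup.mul_mem_sup ha hb

/-- In a commutative group of order `m * n` with `gcd(m, n) = 1`, the `m`-kernel and the
`n`-kernel are complementary subgroups (multiplication `powKer m × powKer n → G` is a bijection). -/
theorem isComplement'_powKer {m n : ℕ} (h : Nat.Coprime m n) (hcard : Nat.card G = m * n) :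
    IsComplement' (powKer G m) (powKer G n) := by
  have hG : ∀ g : G, g ^ (m * n) = 1 := fun g => by rw [← hcard]; exact pow_card_eq_one'
  refine isComplement'_of_disjoint_and_mul_eq_univ (powKer_disjoint h) ?_
  rw [← Subgroup.mul_normal, powKer_sup_eq_top h hG, Subgroup.coe_top]

/-- The multiplication map `powKer m × powKer n →* G`, `(a, b) ↦ a * b`. -/
def mulHom (m n : ℕ) : powKer G m × powKer G n →* G :=
  (powKer G m).subtype.coprod (powKer G n).subtype

/-- `mulHom` is multiplication. -/
theorem mulHom_apply {m n : ℕ} (x : powKer G m × powKer G n) :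
    mulHom m n x = (x.1 : G) * (x.2 : G) := rfl

section Finite

variable [Finite G]

/-- Every prime divisor of the order of the `m`-kernel divides `m` (Cauchy). -/
theorem prime_dvd_of_dvd_card_powKer {m p : ℕ} (hp : p.Prime) (hdvd : p ∣ Nat.card (powKer G m)) :
    p ∣ m := by
  haveI : Fact p.Prime := ⟨hp⟩
  obtain ⟨x, hx⟩ := exists_prime_orderOf_dvd_card' (G := powKer G m) p hdvd
  rw [← hx, ← Subgroup.orderOf_coe]
  exact orderOf_dvd_of_pow_eq_one x.2

/-- The order of the `m`-kernel is coprime to `n` when `gcd(m, n) = 1`. -/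
theorem coprime_card_powKer {m n : ℕ} (h : Nat.Coprime m n) :
    Nat.Coprime (Nat.card (powKer G m)) n := by
  refine Nat.coprime_of_dvd fun k hk hkm hkn => ?_
  have hk1 : k ∣ 1 := by
    rw [← h.gcd_eq_one]
    exact Nat.dvd_gcd (prime_dvd_of_dvd_card_powKer hk hkm) hkn
  exact hk.one_lt.ne' (Nat.dvd_one.mp hk1)

/-- The order of the `m`-kernel divides `m` when `Nat.card G = m * n` and `gcd(m, n) = 1`
(Lagrange + coprimality). -/
theorem card_powKer_dvd {m n : ℕ} (h : Nat.Coprime m n) (hcard : Nat.card G = m * n) :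
    Nat.card (powKer G m) ∣ m :=
  (coprime_card_powKer h).dvd_of_dvd_mul_right (hcard ▸ card_subgroup_dvd_card (powKer G m))

/-- The `m`-kernel has order exactly `m`. -/
theorem card_powKer_left {m n : ℕ} (h : Nat.Coprime m n) (hcard : Nat.card G = m * n) :
    Nat.card (powKer G m) = m := by
  have hmul := (isComplement'_powKer h hcard).card_mul
  rw [hcard] at hmul
  obtain ⟨a, ha⟩ := card_powKer_dvd h hcard
  obtain ⟨b, hb⟩ := card_powKer_dvd h.symm (by rw [hcard, mul_comm])
  have hpos : 0 < Nat.card (powKer G m) := Nat.card_pos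
  have hpos' : 0 < Nat.card (powKer G n) := Nat.card_pos
  -- `c * d = (c * a) * (d * b)` with `c, d > 0` forces `a * b = 1`.
  have hab : a * b = 1 := by
    have : Nat.card (powKer G m) * Nat.card (powKer G n) * (a * b) =
        Nat.card (powKer G m) * Nat.card (powKer G n) * 1 := by
      calc Nat.card (powKer G m) * Nat.card (powKer G n) * (a * b)
          = (Nat.card (powKer G m) * a) * (Nat.card (powKer G n) * b) := by ring
        _ = m * n := by rw [← ha, ← hb]
        _ = Nat.card (powKer G m) * Nat.card (powKer G n) * 1 := by rw [hmul, mul_one]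
    exact Nat.eq_of_mul_eq_mul_left (Nat.mul_pos hpos hpos') this
  have ha1 : a = 1 := Nat.eq_one_of_mul_eq_one_right hab
  rw [ha1, mul_one] at ha
  exact ha.symm

/-- The `n`-kernel has order exactly `n`. -/
theorem card_powKer_right {m n : ℕ} (h : Nat.Coprime m n) (hcard : Nat.card G = m * n) :
    Nat.card (powKer G n) = n :=
  card_powKer_left h.symm (by rw [hcard, mul_comm])

end Finite

/-- THE STANDARD FACT (A3)(c): a finite commutative group of order `m * n`, `gcd(m, n) = 1`, is the
(internal) direct product of its subgroups `{g | g ^ m = 1}` (of order `m`, `card_powKer_left`) and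
`{g | g ^ n = 1}` (of order `n`, `card_powKer_right`): multiplication is a group isomorphism
`powKer m × powKer n ≃* G`. (Stated without a finiteness hypothesis: `Nat.card G = m * n` with
`gcd(m, n) = 1` already forces the conclusion — for infinite `G` one of `m, n` is `0`, the other `1`.) -/
noncomputable def mulEquivProd {m n : ℕ} (h : Nat.Coprime m n) (hcard : Nat.card G = m * n) :
    powKer G m × powKer G n ≃* G :=
  MulEquiv.ofBijective (mulHom m n) (isComplement'_powKer h hcard)

/-- The isomorphism is multiplication. -/
theorem mulEquivProd_apply {m n : ℕ} (h : Nat.Coprime m n) (hcard : Nat.card G = m * n)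
    (x : powKer G m × powKer G n) : mulEquivProd h hcard x = (x.1 : G) * (x.2 : G) := rfl

/-- Every element of `G` factors uniquely as `a * b` with `a ^ m = 1`, `b ^ n = 1`. -/
theorem existsUnique_factorisation {m n : ℕ} (h : Nat.Coprime m n) (hcard : Nat.card G = m * n)
    (g : G) : ∃! x : powKer G m × powKer G n, (x.1 : G) * (x.2 : G) = g := by
  obtain ⟨x, hx⟩ := (isComplement'_powKer h hcard).2 g
  refine ⟨x, hx, fun y hy => (isComplement'_powKer h hcard).1 (hy.trans hx.symm)⟩

/-! ### v2 (append-only): the two uses of the decomposition in Theorem N5.T3's auxiliary-place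
construction (`route/T5-route-2.md` §N5.11.6) — «μ(E) injects into G and its image lies in G″
(orders prime to q_w)» and «θ := φ¹ ⊗ φ, a character of G = G¹ × G″» -/

section Assembly

/-- An element whose order is prime to `m` lies in the `n`-kernel (`Nat.card G = m * n`):
the image of `μ(E)` (orders prime to `q_w`) lies in `G″` (of order `q_w + 1`). -/
theorem mem_powKer_of_coprime_orderOf {m n : ℕ} (hcard : Nat.card G = m * n) {g : G}
    (hg : Nat.Coprime (orderOf g) m) : g ∈ powKer G n := by
  rw [mem_powKer, ← orderOf_dvd_iff_pow_eq_one]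
  have h : orderOf g ∣ m * n := hcard ▸ orderOf_dvd_natCard g
  exact hg.dvd_of_dvd_mul_left h

/-- A subgroup whose order is prime to `m` lies in the `n`-kernel. -/
theorem le_powKer_of_coprime_card {m n : ℕ} (hcard : Nat.card G = m * n) (H : Subgroup G)
    (hH : Nat.Coprime (Nat.card H) m) : H ≤ powKer G n := by
  intro g hg
  refine mem_powKer_of_coprime_orderOf hcard (Nat.Coprime.coprime_dvd_left ?_ hH)
  rw [← Subgroup.orderOf_mk g hg]
  exact orderOf_dvd_natCard (⟨g, hg⟩ : H)

variable {Q : Type*} [CommMonoid Q]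

/-- Characters `φ₁` of the `m`-kernel and `φ₂` of the `n`-kernel assemble to the character
`θ = φ₁ ⊗ φ₂` of `G` («θ := φ¹ ⊗ φ, a character of G = G¹ × G″»): `θ (a * b) = φ₁ a * φ₂ b`. -/
noncomputable def charProd {m n : ℕ} (h : Nat.Coprime m n) (hcard : Nat.card G = m * n)
    (φ₁ : powKer G m →* Q) (φ₂ : powKer G n →* Q) : G →* Q :=
  (φ₁.coprod φ₂).comp (mulEquivProd h hcard).symm.toMonoidHom

/-- `θ (a * b) = φ₁ a * φ₂ b` for `a` in the `m`-kernel and `b` in the `n`-kernel. -/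
theorem charProd_apply_mul {m n : ℕ} (h : Nat.Coprime m n) (hcard : Nat.card G = m * n)
    (φ₁ : powKer G m →* Q) (φ₂ : powKer G n →* Q) (a : powKer G m) (b : powKer G n) :
    charProd h hcard φ₁ φ₂ ((a : G) * (b : G)) = φ₁ a * φ₂ b := by
  have hsymm : (mulEquivProd h hcard).symm ((a : G) * (b : G)) = (a, b) := by
    rw [MulEquiv.symm_apply_eq]
    rfl
  simp only [charProd, MonoidHom.comp_apply, MulEquiv.toMonoidHom_eq_coe, MonoidHom.coe_coe,
    hsymm, MonoidHom.coprod_apply]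

/-- `θ` restricts to `φ₁` on the `m`-kernel. -/
theorem charProd_apply_left {m n : ℕ} (h : Nat.Coprime m n) (hcard : Nat.card G = m * n)
    (φ₁ : powKer G m →* Q) (φ₂ : powKer G n →* Q) (a : powKer G m) :
    charProd h hcard φ₁ φ₂ a = φ₁ a := by
  have := charProd_apply_mul h hcard φ₁ φ₂ a 1
  simpa using this

/-- `θ` restricts to `φ₂` on the `n`-kernel. -/
theorem charProd_apply_right {m n : ℕ} (h : Nat.Coprime m n) (hcard : Nat.card G = m * n)
    (φ₁ : powKer G m →* Q) (φ₂ : powKer G n →* Q) (b : powKer G n) :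
    charProd h hcard φ₁ φ₂ b = φ₂ b := by
  have := charProd_apply_mul h hcard φ₁ φ₂ 1 b
  simpa using this

/-- The restriction of `θ` to a subgroup `H` contained in the `n`-kernel is the restriction of
`φ₂` (the step «χ_{i,w}|_{μ(E)} = ρ_i⁻¹, φ¹ being trivial on G″ ⊃ image of μ(E)»). -/
theorem charProd_apply_of_mem_right {m n : ℕ} (h : Nat.Coprime m n) (hcard : Nat.card G = m * n)
    (φ₁ : powKer G m →* Q) (φ₂ : powKer G n →* Q) {g : G} (hg : g ∈ powKer G n) :
    charProd h hcard φ₁ φ₂ g = φ₂ ⟨g, hg⟩ :=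
  charProd_apply_right h hcard φ₁ φ₂ ⟨g, hg⟩

end Assembly

end Summit.Ventures.HodgeRepro2.T5CoprimeDecomposition
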